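import Summits.QuantumFields.YangMills.Theorems.FluctuationComparisonRegPrIntLS2BetaDescendedBlock
import Summits.QuantumFields.YangMills.Theorems.FluctuationComparisonRegPrIntLS2BetaSectionsColourTable
import HarnessLib

/-!
# S2β · D-GUARD ∕ (BG∞) — (L-Σ) PART 2∕5: (DESC) EVERY SECTION CONTINUES THE DESCENDED BLOCK'S, HENCE (CONS) THE SECTIONS ARE CONSISTENT ON OVERLAPS (UV3-NODE §116 ADD.1∕ADD.2)

Cell `ym3-torus` (YM ladder rung R3 = continuum `SU(2)` Yang–Mills on the three-torus at fixed lattice data — a RUNG: NOT d = 4, NOT infinite volume,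
NOT a mass gap, NOT Clay).  Width seat «width 19» `ym3-torus-px19` (gen 25, ★p1 lineage), FREE px helper on crux `stmt-QuantumFields-20520`
(`FluctuationComparisonRegPrIntL`; registry `Lines/semiclassical_s2beta.lean` UNTOUCHED, 0∕5); `--kind proof --supports stmt-QuantumFields-20520 --as helper`,
count-neutral, DEFINITION-FREE (0 `def`, 0 `instance`, 0 `notation`, 0 `sorry`, default heartbeats).  (BG∞) plan of record: UV3-NODE §116 + ADD.1 + ADD.2
(architect ruling px17 g23 2026-09-01T00:13:02Z; desk RULINGs №123 ∕ №127 (binder style) ∕ №132-A; LEAD RULINGs №66 ∕ №67).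

WHY.  With the descent function `D` of ✓`…DescendedBlock` and the eight-colour table of ✓`…SectionsColourTable`, the fillings are required to AGREE on the odd faces
of their block with the datum read from the descended block (`hA1`, `hA2`, `hA3`: the first clauses of the three filling letters, displayed).  Then on any `x ∈ Q̄`
the glued field `w Q x · g Q x` equals the descended block's (DESC), and two closed blocks containing `x` descend to the SAME block (✓`dblock_agrees`) — (CONS).

WHAT IS PROVED (sorry-free).  `dflag_of_not`, `dflag_even_of_even`, `dflag_even_of_face` (parity flags of the descended block); `dkey1∕2∕3` (on an odd face the
descended block is seen by the truncated table); `desc_stage1∕2∕3`, ★★`desc`; ★★★`cons (hx : x ∈ Q̄) (hx′ : x ∈ Q̄′) : w Q x · g Q x = w Q′ x · g Q′ x`.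

HONEST SCOPE.  Bookkeeping and group algebra over DISPLAYED hypotheses (the eight-colour table and the filling data are carried as functions PINNED by displayed
equations, in the style of ✓p839983's `hW`; nothing is defined).  The three FILLING LETTERS are HYPOTHESES of the final theorem (file (Σ-B5)); until they are
discharged ((L-I) ✓p839983, (L-T)∕(R3) px5, (L-S) px8, with the cone-centre lemmas (B3′)∕(B3-S)) `hSec`, hence `hBG`, (BG∞), `hsupp⁺` and D-GUARD's two `hsupp`
letters are NOT proved.  Nothing of Bałaban's renormalisation-group analysis is asserted or proved ([Balaban1985RegularSpaces] Lemma 1 p.79 ∕ (1.29) p.81 is the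
local, non-uniform statement in print; the N-uniform torus gluing is the (BG∞) plan's, NOT in print).  GAP♯∘ (`stub_uniformFibreGapOrbit`, registry UNTOUCHED), the
five registered stubs (0∕5), S2β, 20520, 19936, 19200, `YM3TorusSU2` are NOT proved; no registered stub is closed; rung R3 — NOT d = 4, NOT infinite volume, NOT a
mass gap, NOT Clay; the Yang–Mills mass gap is NOT proved.  Axioms standard.

References: T. Bałaban, CMP **99** (1985) 75–102 [Balaban1985RegularSpaces] (Lemma 1 p.79, (1.29) p.81).
-/

set_option autoImplicit false

namespace Summit.QuantumFields.YangMills.Theorems.FluctuationComparisonRegPrIntLS2BetaSectionsDescentConsistency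

open Literature.MathematicalPhysics.QuantumFieldTheory.Balaban1983to89
open T4CubeChartGnomonic (SU2)
open Summit.QuantumFields.YangMills.Theorems.FluctuationComparisonRegPrIntLS2BetaDescendedBlock
open Summit.QuantumFields.YangMills.Theorems.FluctuationComparisonRegPrIntLS2BetaSectionsColourTable

section Blocks
variable {P : Params} {M : ℕ} (len start : Fin M → ℕ)
  (hlen1 : ∀ i, 1 ≤ len i)
  (hz : ∀ i : Fin M, (i : ℕ) = 0 → start i = 0)
  (hs : ∀ i j : Fin M, (j : ℕ) = (i : ℕ) + 1 → start j = start i + len i)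
  (hl : ∀ i : Fin M, (i : ℕ) + 1 = M → start i + len i = P.sitesPerDir 0) (hM : 3 ≤ M) (hEven : Even M)
  (D : Fin M → ZMod (P.sitesPerDir 0) → Fin M)
  (hD : ∀ (i : Fin M) (v : ZMod (P.sitesPerDir 0)),
      ((i : ℕ) % 2 = 1 ∧ (v - ((start i : ℕ) : ZMod (P.sitesPerDir 0))).val = 0 ∧ ((i : ℕ) = (D i v : ℕ) + 1 ∨ ((D i v : ℕ) + 1 = M ∧ (i : ℕ) = 0))) ∨
      ((i : ℕ) % 2 = 1 ∧ (v - ((start i : ℕ) : ZMod (P.sitesPerDir 0))).val = len i ∧ ((D i v : ℕ) = (i : ℕ) + 1 ∨ ((i : ℕ) + 1 = M ∧ (D i v : ℕ) = 0))) ∨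
      (¬ ((i : ℕ) % 2 = 1 ∧ ((v - ((start i : ℕ) : ZMod (P.sitesPerDir 0))).val = 0 ∨ (v - ((start i : ℕ) : ZMod (P.sitesPerDir 0))).val = len i)) ∧
        D i v = i))
  (κ0 κ1 κ2 : Fin P.d) (htri : ∀ κ : Fin P.d, κ = κ0 ∨ κ = κ1 ∨ κ = κ2)
  (g : (Fin P.d → Fin M) → Site P 0 → SU2)
  (W₁ : (Fin P.d → Fin M) → Fin P.d → Site P 0 → SU2)
  (W₂ : (Fin P.d → Fin M) → Fin P.d → Fin P.d → Site P 0 → SU2)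
  (W₃ : (Fin P.d → Fin M) → Site P 0 → SU2)
  (wle1 wle2 w : (Fin P.d → Fin M) → Site P 0 → SU2)
  (hwle1 : ∀ R x, wle1 R x =
    if ((R κ0 : Fin M) : ℕ) % 2 = 1 then (if ((R κ1 : Fin M) : ℕ) % 2 = 1 then 1 else if ((R κ2 : Fin M) : ℕ) % 2 = 1 then 1 else W₁ R κ0 x)
    else (if ((R κ1 : Fin M) : ℕ) % 2 = 1 then (if ((R κ2 : Fin M) : ℕ) % 2 = 1 then 1 else W₁ R κ1 x)
      else (if ((R κ2 : Fin M) : ℕ) % 2 = 1 then W₁ R κ2 x else 1)))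
  (hwle2 : ∀ R x, wle2 R x =
    if ((R κ0 : Fin M) : ℕ) % 2 = 1 then (if ((R κ1 : Fin M) : ℕ) % 2 = 1 then (if ((R κ2 : Fin M) : ℕ) % 2 = 1 then 1 else W₂ R κ0 κ1 x)
      else (if ((R κ2 : Fin M) : ℕ) % 2 = 1 then W₂ R κ0 κ2 x else W₁ R κ0 x))
    else (if ((R κ1 : Fin M) : ℕ) % 2 = 1 then (if ((R κ2 : Fin M) : ℕ) % 2 = 1 then W₂ R κ1 κ2 x else W₁ R κ1 x)
      else (if ((R κ2 : Fin M) : ℕ) % 2 = 1 then W₁ R κ2 x else 1)))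
  (hw : ∀ R x, w R x =
    if ((R κ0 : Fin M) : ℕ) % 2 = 1 then (if ((R κ1 : Fin M) : ℕ) % 2 = 1 then (if ((R κ2 : Fin M) : ℕ) % 2 = 1 then W₃ R x else W₂ R κ0 κ1 x)
      else (if ((R κ2 : Fin M) : ℕ) % 2 = 1 then W₂ R κ0 κ2 x else W₁ R κ0 x))
    else (if ((R κ1 : Fin M) : ℕ) % 2 = 1 then (if ((R κ2 : Fin M) : ℕ) % 2 = 1 then W₂ R κ1 κ2 x else W₁ R κ1 x)
      else (if ((R κ2 : Fin M) : ℕ) % 2 = 1 then W₁ R κ2 x else 1)))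
  (hA1 : ∀ (Q : Fin P.d → Fin M) (α : Fin P.d) (x : Site P 0),
      (∀ κ, (x κ - ((start (Q κ) : ℕ) : ZMod (P.sitesPerDir 0))).val ≤ len (Q κ)) →
      ((x α - ((start (Q α) : ℕ) : ZMod (P.sitesPerDir 0))).val = 0 ∨ (x α - ((start (Q α) : ℕ) : ZMod (P.sitesPerDir 0))).val = len (Q α)) →
      W₁ Q α x = g (fun κ => D (Q κ) (x κ)) x * (g Q x)⁻¹)
  (hA2 : ∀ (Q : Fin P.d → Fin M) (α β : Fin P.d) (x : Site P 0),
      (∀ κ, (x κ - ((start (Q κ) : ℕ) : ZMod (P.sitesPerDir 0))).val ≤ len (Q κ)) →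
      (((x α - ((start (Q α) : ℕ) : ZMod (P.sitesPerDir 0))).val = 0 ∨ (x α - ((start (Q α) : ℕ) : ZMod (P.sitesPerDir 0))).val = len (Q α)) ∨
        ((x β - ((start (Q β) : ℕ) : ZMod (P.sitesPerDir 0))).val = 0 ∨ (x β - ((start (Q β) : ℕ) : ZMod (P.sitesPerDir 0))).val = len (Q β))) →
      W₂ Q α β x = wle1 (fun κ => D (Q κ) (x κ)) x * g (fun κ => D (Q κ) (x κ)) x * (g Q x)⁻¹)
  (hA3 : ∀ (Q : Fin P.d → Fin M) (x : Site P 0),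
      (∀ κ, (x κ - ((start (Q κ) : ℕ) : ZMod (P.sitesPerDir 0))).val ≤ len (Q κ)) →
      (∃ κ, (x κ - ((start (Q κ) : ℕ) : ZMod (P.sitesPerDir 0))).val = 0 ∨ (x κ - ((start (Q κ) : ℕ) : ZMod (P.sitesPerDir 0))).val = len (Q κ)) →
      W₃ Q x = wle2 (fun κ => D (Q κ) (x κ)) x * g (fun κ => D (Q κ) (x κ)) x * (g Q x)⁻¹)

include hD in
/-- Along an axis that is even, or odd but with the site off its faces, the descended block has the block's parity. [folklore] -/
theorem dflag_of_not (Q : Fin P.d → Fin M) (x : Site P 0) (κ : Fin P.d)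
    (h : ¬ (((Q κ : Fin M) : ℕ) % 2 = 1 ∧ ((x κ - ((start (Q κ) : ℕ) : ZMod (P.sitesPerDir 0))).val = 0 ∨
      (x κ - ((start (Q κ) : ℕ) : ZMod (P.sitesPerDir 0))).val = len (Q κ)))) :
    ((D (Q κ) (x κ) : Fin M) : ℕ) % 2 = ((Q κ : Fin M) : ℕ) % 2 := by
  rw [descentFun_eq_self len start D hD (Q κ) (x κ) h]

include hD in
/-- Along an even axis the descended block is even. [folklore] -/
theorem dflag_even_of_even (Q : Fin P.d → Fin M) (x : Site P 0) (κ : Fin P.d) (h : ¬ ((Q κ : Fin M) : ℕ) % 2 = 1) :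
    ¬ ((D (Q κ) (x κ) : Fin M) : ℕ) % 2 = 1 := by
  rw [dflag_of_not len start D hD Q x κ (fun h' => h h'.1)]; exact h

include hEven hD in
/-- On an odd face the descended block is even along that axis. [folklore] -/
theorem dflag_even_of_face (Q : Fin P.d → Fin M) (x : Site P 0) (κ : Fin P.d) (ho : ((Q κ : Fin M) : ℕ) % 2 = 1)
    (hf : (x κ - ((start (Q κ) : ℕ) : ZMod (P.sitesPerDir 0))).val = 0 ∨ (x κ - ((start (Q κ) : ℕ) : ZMod (P.sitesPerDir 0))).val = len (Q κ)) :
    ¬ ((D (Q κ) (x κ) : Fin M) : ℕ) % 2 = 1 := by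
  have := descentFun_even_of_face len start hEven D hD (Q κ) (x κ) ho hf
  omega

include hEven hD hw in
/-- On an odd face of a stage-1 block the descended block is of stage 0: its section is `1`. [folklore] -/
theorem dkey1 (Q : Fin P.d → Fin M) (x : Site P 0) (α : Fin P.d)
    (hα : (α = κ0 ∧ ((Q κ0 : Fin M) : ℕ) % 2 = 1 ∧ ¬ ((Q κ1 : Fin M) : ℕ) % 2 = 1 ∧ ¬ ((Q κ2 : Fin M) : ℕ) % 2 = 1) ∨
      (α = κ1 ∧ ¬ ((Q κ0 : Fin M) : ℕ) % 2 = 1 ∧ ((Q κ1 : Fin M) : ℕ) % 2 = 1 ∧ ¬ ((Q κ2 : Fin M) : ℕ) % 2 = 1) ∨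
      (α = κ2 ∧ ¬ ((Q κ0 : Fin M) : ℕ) % 2 = 1 ∧ ¬ ((Q κ1 : Fin M) : ℕ) % 2 = 1 ∧ ((Q κ2 : Fin M) : ℕ) % 2 = 1))
    (hf : (x α - ((start (Q α) : ℕ) : ZMod (P.sitesPerDir 0))).val = 0 ∨ (x α - ((start (Q α) : ℕ) : ZMod (P.sitesPerDir 0))).val = len (Q α)) :
    w (fun κ => D (Q κ) (x κ)) x = 1 := by
  rcases hα with ⟨hαe, h0, h1, h2⟩ | ⟨hαe, h0, h1, h2⟩ | ⟨hαe, h0, h1, h2⟩ <;> rw [hαe] at hf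
  · exact w_eq_one κ0 κ1 κ2 W₁ W₂ W₃ w hw _ x (dflag_even_of_face len start hEven D hD Q x κ0 h0 hf)
      (dflag_even_of_even len start D hD Q x κ1 h1) (dflag_even_of_even len start D hD Q x κ2 h2)
  · exact w_eq_one κ0 κ1 κ2 W₁ W₂ W₃ w hw _ x (dflag_even_of_even len start D hD Q x κ0 h0)
      (dflag_even_of_face len start hEven D hD Q x κ1 h1 hf) (dflag_even_of_even len start D hD Q x κ2 h2)
  · exact w_eq_one κ0 κ1 κ2 W₁ W₂ W₃ w hw _ x (dflag_even_of_even len start D hD Q x κ0 h0)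
      (dflag_even_of_even len start D hD Q x κ1 h1) (dflag_even_of_face len start hEven D hD Q x κ2 h2 hf)

include hEven hD hwle1 hw in
/-- On an odd face of a stage-2 block the descended block is of stage ≤ 1: the stage-≤1 table sees its section. [folklore] -/
theorem dkey2 (Q : Fin P.d → Fin M) (x : Site P 0) (α β : Fin P.d)
    (hαβ : (α = κ0 ∧ β = κ1 ∧ ((Q κ0 : Fin M) : ℕ) % 2 = 1 ∧ ((Q κ1 : Fin M) : ℕ) % 2 = 1 ∧ ¬ ((Q κ2 : Fin M) : ℕ) % 2 = 1) ∨
      (α = κ0 ∧ β = κ2 ∧ ((Q κ0 : Fin M) : ℕ) % 2 = 1 ∧ ¬ ((Q κ1 : Fin M) : ℕ) % 2 = 1 ∧ ((Q κ2 : Fin M) : ℕ) % 2 = 1) ∨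
      (α = κ1 ∧ β = κ2 ∧ ¬ ((Q κ0 : Fin M) : ℕ) % 2 = 1 ∧ ((Q κ1 : Fin M) : ℕ) % 2 = 1 ∧ ((Q κ2 : Fin M) : ℕ) % 2 = 1))
    (hf : ((x α - ((start (Q α) : ℕ) : ZMod (P.sitesPerDir 0))).val = 0 ∨ (x α - ((start (Q α) : ℕ) : ZMod (P.sitesPerDir 0))).val = len (Q α)) ∨
      ((x β - ((start (Q β) : ℕ) : ZMod (P.sitesPerDir 0))).val = 0 ∨ (x β - ((start (Q β) : ℕ) : ZMod (P.sitesPerDir 0))).val = len (Q β))) :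
    wle1 (fun κ => D (Q κ) (x κ)) x = w (fun κ => D (Q κ) (x κ)) x := by
  have key : ¬ ((((D (Q κ0) (x κ0) : Fin M) : ℕ) % 2 = 1 ∧ ((D (Q κ1) (x κ1) : Fin M) : ℕ) % 2 = 1) ∨
      (((D (Q κ0) (x κ0) : Fin M) : ℕ) % 2 = 1 ∧ ((D (Q κ2) (x κ2) : Fin M) : ℕ) % 2 = 1) ∨
      (((D (Q κ1) (x κ1) : Fin M) : ℕ) % 2 = 1 ∧ ((D (Q κ2) (x κ2) : Fin M) : ℕ) % 2 = 1)) := by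
    rcases hαβ with ⟨hαe, hβe, h0, h1, h2⟩ | ⟨hαe, hβe, h0, h1, h2⟩ | ⟨hαe, hβe, h0, h1, h2⟩ <;> rw [hαe, hβe] at hf
    · have e2 := dflag_even_of_even len start D hD Q x κ2 h2
      rcases hf with hf | hf
      · have e := dflag_even_of_face len start hEven D hD Q x κ0 h0 hf; tauto
      · have e := dflag_even_of_face len start hEven D hD Q x κ1 h1 hf; tauto
    · have e1 := dflag_even_of_even len start D hD Q x κ1 h1
      rcases hf with hf | hf
      · have e := dflag_even_of_face len start hEven D hD Q x κ0 h0 hf; tauto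
      · have e := dflag_even_of_face len start hEven D hD Q x κ2 h2 hf; tauto
    · have e0 := dflag_even_of_even len start D hD Q x κ0 h0
      rcases hf with hf | hf
      · have e := dflag_even_of_face len start hEven D hD Q x κ1 h1 hf; tauto
      · have e := dflag_even_of_face len start hEven D hD Q x κ2 h2 hf; tauto
  exact wle1_eq_w κ0 κ1 κ2 W₁ W₂ W₃ wle1 w hwle1 hw _ x key

include hEven hD htri hwle2 hw in
/-- On a face of a stage-3 block the descended block is of stage ≤ 2: the stage-≤2 table sees its section. [folklore] -/
theorem dkey3 (Q : Fin P.d → Fin M) (x : Site P 0)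
    (h0 : ((Q κ0 : Fin M) : ℕ) % 2 = 1) (h1 : ((Q κ1 : Fin M) : ℕ) % 2 = 1) (h2 : ((Q κ2 : Fin M) : ℕ) % 2 = 1)
    (hf : ∃ κ, (x κ - ((start (Q κ) : ℕ) : ZMod (P.sitesPerDir 0))).val = 0 ∨ (x κ - ((start (Q κ) : ℕ) : ZMod (P.sitesPerDir 0))).val = len (Q κ)) :
    wle2 (fun κ => D (Q κ) (x κ)) x = w (fun κ => D (Q κ) (x κ)) x := by
  obtain ⟨κ, hκ⟩ := hf
  have key : ¬ (((D (Q κ0) (x κ0) : Fin M) : ℕ) % 2 = 1 ∧ ((D (Q κ1) (x κ1) : Fin M) : ℕ) % 2 = 1 ∧ ((D (Q κ2) (x κ2) : Fin M) : ℕ) % 2 = 1) := by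
    rcases htri κ with hκe | hκe | hκe <;> rw [hκe] at hκ
    · have e := dflag_even_of_face len start hEven D hD Q x κ0 h0 hκ; tauto
    · have e := dflag_even_of_face len start hEven D hD Q x κ1 h1 hκ; tauto
    · have e := dflag_even_of_face len start hEven D hD Q x κ2 h2 hκ; tauto
  exact wle2_eq_w κ0 κ1 κ2 W₁ W₂ W₃ wle2 w hwle2 hw _ x key

include hEven hD hw hA1 in
/-- **(DESC₁)** a stage-1 section continues the (trivial) section of the descended block on its odd faces. [folklore] -/
theorem desc_stage1 (Q : Fin P.d → Fin M) (x : Site P 0) (α : Fin P.d)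
    (hα : (α = κ0 ∧ ((Q κ0 : Fin M) : ℕ) % 2 = 1 ∧ ¬ ((Q κ1 : Fin M) : ℕ) % 2 = 1 ∧ ¬ ((Q κ2 : Fin M) : ℕ) % 2 = 1) ∨
      (α = κ1 ∧ ¬ ((Q κ0 : Fin M) : ℕ) % 2 = 1 ∧ ((Q κ1 : Fin M) : ℕ) % 2 = 1 ∧ ¬ ((Q κ2 : Fin M) : ℕ) % 2 = 1) ∨
      (α = κ2 ∧ ¬ ((Q κ0 : Fin M) : ℕ) % 2 = 1 ∧ ¬ ((Q κ1 : Fin M) : ℕ) % 2 = 1 ∧ ((Q κ2 : Fin M) : ℕ) % 2 = 1))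
    (hx : ∀ κ, (x κ - ((start (Q κ) : ℕ) : ZMod (P.sitesPerDir 0))).val ≤ len (Q κ))
    (hf : (x α - ((start (Q α) : ℕ) : ZMod (P.sitesPerDir 0))).val = 0 ∨ (x α - ((start (Q α) : ℕ) : ZMod (P.sitesPerDir 0))).val = len (Q α)) :
    w Q x * g Q x = w (fun κ => D (Q κ) (x κ)) x * g (fun κ => D (Q κ) (x κ)) x := by
  rw [w_eq_W1 κ0 κ1 κ2 W₁ W₂ W₃ w hw Q x α hα, hA1 Q α x hx hf, inv_mul_cancel_right,
    dkey1 len start hEven D hD κ0 κ1 κ2 W₁ W₂ W₃ w hw Q x α hα hf, one_mul]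

include hEven hD hwle1 hw hA2 in
/-- **(DESC₂)** a stage-2 section continues the section of the descended block on its odd faces. [folklore] -/
theorem desc_stage2 (Q : Fin P.d → Fin M) (x : Site P 0) (α β : Fin P.d)
    (hαβ : (α = κ0 ∧ β = κ1 ∧ ((Q κ0 : Fin M) : ℕ) % 2 = 1 ∧ ((Q κ1 : Fin M) : ℕ) % 2 = 1 ∧ ¬ ((Q κ2 : Fin M) : ℕ) % 2 = 1) ∨
      (α = κ0 ∧ β = κ2 ∧ ((Q κ0 : Fin M) : ℕ) % 2 = 1 ∧ ¬ ((Q κ1 : Fin M) : ℕ) % 2 = 1 ∧ ((Q κ2 : Fin M) : ℕ) % 2 = 1) ∨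
      (α = κ1 ∧ β = κ2 ∧ ¬ ((Q κ0 : Fin M) : ℕ) % 2 = 1 ∧ ((Q κ1 : Fin M) : ℕ) % 2 = 1 ∧ ((Q κ2 : Fin M) : ℕ) % 2 = 1))
    (hx : ∀ κ, (x κ - ((start (Q κ) : ℕ) : ZMod (P.sitesPerDir 0))).val ≤ len (Q κ))
    (hf : ((x α - ((start (Q α) : ℕ) : ZMod (P.sitesPerDir 0))).val = 0 ∨ (x α - ((start (Q α) : ℕ) : ZMod (P.sitesPerDir 0))).val = len (Q α)) ∨
      ((x β - ((start (Q β) : ℕ) : ZMod (P.sitesPerDir 0))).val = 0 ∨ (x β - ((start (Q β) : ℕ) : ZMod (P.sitesPerDir 0))).val = len (Q β))) :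
    w Q x * g Q x = w (fun κ => D (Q κ) (x κ)) x * g (fun κ => D (Q κ) (x κ)) x := by
  rw [w_eq_W2 κ0 κ1 κ2 W₁ W₂ W₃ w hw Q x α β hαβ, hA2 Q α β x hx hf, inv_mul_cancel_right,
    dkey2 len start hEven D hD κ0 κ1 κ2 W₁ W₂ W₃ wle1 w hwle1 hw Q x α β hαβ hf]

include hEven hD htri hwle2 hw hA3 in
/-- **(DESC₃)** a stage-3 section continues the section of the descended block on its faces. [folklore] -/
theorem desc_stage3 (Q : Fin P.d → Fin M) (x : Site P 0)
    (h0 : ((Q κ0 : Fin M) : ℕ) % 2 = 1) (h1 : ((Q κ1 : Fin M) : ℕ) % 2 = 1) (h2 : ((Q κ2 : Fin M) : ℕ) % 2 = 1)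
    (hx : ∀ κ, (x κ - ((start (Q κ) : ℕ) : ZMod (P.sitesPerDir 0))).val ≤ len (Q κ))
    (hf : ∃ κ, (x κ - ((start (Q κ) : ℕ) : ZMod (P.sitesPerDir 0))).val = 0 ∨ (x κ - ((start (Q κ) : ℕ) : ZMod (P.sitesPerDir 0))).val = len (Q κ)) :
    w Q x * g Q x = w (fun κ => D (Q κ) (x κ)) x * g (fun κ => D (Q κ) (x κ)) x := by
  rw [w_eq_W3 κ0 κ1 κ2 W₁ W₂ W₃ w hw Q x h0 h1 h2, hA3 Q x hx hf, inv_mul_cancel_right,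
    dkey3 len start hEven D hD κ0 κ1 κ2 htri W₁ W₂ W₃ wle2 w hwle2 hw Q x h0 h1 h2 hf]

include hEven hD htri hwle1 hwle2 hw hA1 hA2 hA3 in
/-- ★★ **(DESC) EVERY SECTION CONTINUES THE SECTION OF THE DESCENDED BLOCK**: `w Q x · g Q x = w (D(Q,x)) x · g (D(Q,x)) x` for `x ∈ Q̄`. [folklore] -/
theorem desc (Q : Fin P.d → Fin M) (x : Site P 0) (hx : ∀ κ, (x κ - ((start (Q κ) : ℕ) : ZMod (P.sitesPerDir 0))).val ≤ len (Q κ)) :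
    w Q x * g Q x = w (fun κ => D (Q κ) (x κ)) x * g (fun κ => D (Q κ) (x κ)) x := by
  by_cases hF : ∃ κ, ((Q κ : Fin M) : ℕ) % 2 = 1 ∧ ((x κ - ((start (Q κ) : ℕ) : ZMod (P.sitesPerDir 0))).val = 0 ∨
      (x κ - ((start (Q κ) : ℕ) : ZMod (P.sitesPerDir 0))).val = len (Q κ))
  swap
  · rw [dblock_eq_self len start D hD Q x (fun κ h => hF ⟨κ, h⟩)]
  obtain ⟨κf, hof, hff⟩ := hF
  by_cases o0 : ((Q κ0 : Fin M) : ℕ) % 2 = 1 <;> by_cases o1 : ((Q κ1 : Fin M) : ℕ) % 2 = 1 <;> by_cases o2 : ((Q κ2 : Fin M) : ℕ) % 2 = 1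
  · exact desc_stage3 len start hEven D hD κ0 κ1 κ2 htri g W₁ W₂ W₃ wle2 w hwle2 hw hA3 Q x o0 o1 o2 hx ⟨κf, hff⟩
  · refine desc_stage2 len start hEven D hD κ0 κ1 κ2 g W₁ W₂ W₃ wle1 w hwle1 hw hA2 Q x κ0 κ1 (Or.inl ⟨rfl, rfl, o0, o1, o2⟩) hx ?_
    rcases htri κf with rfl | rfl | rfl
    · exact Or.inl hff
    · exact Or.inr hff
    · exact (o2 hof).elim
  · refine desc_stage2 len start hEven D hD κ0 κ1 κ2 g W₁ W₂ W₃ wle1 w hwle1 hw hA2 Q x κ0 κ2 (Or.inr (Or.inl ⟨rfl, rfl, o0, o1, o2⟩)) hx ?_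
    rcases htri κf with rfl | rfl | rfl
    · exact Or.inl hff
    · exact (o1 hof).elim
    · exact Or.inr hff
  · refine desc_stage1 len start hEven D hD κ0 κ1 κ2 g W₁ W₂ W₃ w hw hA1 Q x κ0 (Or.inl ⟨rfl, o0, o1, o2⟩) hx ?_
    rcases htri κf with rfl | rfl | rfl
    · exact hff
    · exact (o1 hof).elim
    · exact (o2 hof).elim
  · refine desc_stage2 len start hEven D hD κ0 κ1 κ2 g W₁ W₂ W₃ wle1 w hwle1 hw hA2 Q x κ1 κ2 (Or.inr (Or.inr ⟨rfl, rfl, o0, o1, o2⟩)) hx ?_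
    rcases htri κf with rfl | rfl | rfl
    · exact (o0 hof).elim
    · exact Or.inl hff
    · exact Or.inr hff
  · refine desc_stage1 len start hEven D hD κ0 κ1 κ2 g W₁ W₂ W₃ w hw hA1 Q x κ1 (Or.inr (Or.inl ⟨rfl, o0, o1, o2⟩)) hx ?_
    rcases htri κf with rfl | rfl | rfl
    · exact (o0 hof).elim
    · exact hff
    · exact (o2 hof).elim
  · refine desc_stage1 len start hEven D hD κ0 κ1 κ2 g W₁ W₂ W₃ w hw hA1 Q x κ2 (Or.inr (Or.inr ⟨rfl, o0, o1, o2⟩)) hx ?_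
    rcases htri κf with rfl | rfl | rfl
    · exact (o0 hof).elim
    · exact (o1 hof).elim
    · exact hff
  · rcases htri κf with rfl | rfl | rfl
    · exact (o0 hof).elim
    · exact (o1 hof).elim
    · exact (o2 hof).elim

include hlen1 hz hs hl hM hEven hD htri hwle1 hwle2 hw hA1 hA2 hA3 in
/-- ★★★ **(CONS) THE SECTIONS ARE CONSISTENT ON OVERLAPS**: `w Q x · g Q x = w Q′ x · g Q′ x` for `x ∈ Q̄ ∩ Q̄′` ((DESC) + ✓`dblock_agrees`). [folklore] -/
theorem cons (Q Q' : Fin P.d → Fin M) (x : Site P 0) (hx : ∀ κ, (x κ - ((start (Q κ) : ℕ) : ZMod (P.sitesPerDir 0))).val ≤ len (Q κ))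
    (hx' : ∀ κ, (x κ - ((start (Q' κ) : ℕ) : ZMod (P.sitesPerDir 0))).val ≤ len (Q' κ)) :
    w Q x * g Q x = w Q' x * g Q' x := by
  rw [desc len start hEven D hD κ0 κ1 κ2 htri g W₁ W₂ W₃ wle1 wle2 w hwle1 hwle2 hw hA1 hA2 hA3 Q x hx,
    desc len start hEven D hD κ0 κ1 κ2 htri g W₁ W₂ W₃ wle1 wle2 w hwle1 hwle2 hw hA1 hA2 hA3 Q' x hx',
    dblock_agrees len start hlen1 hz hs hl hM hEven D hD Q Q' x hx hx']

end Blocks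

end Summit.QuantumFields.YangMills.Theorems.FluctuationComparisonRegPrIntLS2BetaSectionsDescentConsistency
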